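import Summits.BirchSwinnertonDyer.BirchSwinnertonDyer.Theorems.AdditiveBranchIMCTwistConductorDyadic
import Summits.BirchSwinnertonDyer.BirchSwinnertonDyer.Theorems.AdditiveBranchIMCGordTwoRankOneFieldSupplyDyadic
import Literature.NumberTheory.EllipticCurves.QuadraticTwistTwoLFunctionProofs
import Literature.NumberTheory.EllipticCurves.CuspFormTwistAtkinLehnerModulusProofs
import HarnessLib

/-!
# `w(E^{(2ℓ)}) = w(E)` at a NON-SPLIT multiplicative `2` — the root-number engine of the dyadic Wan road
# (crux `AdditiveBranchIMC.GordTwoRankOne`, line `wan_tame_bdp_road` v23, stub `stub_rootNumberDyadicWan : EngineTwo`)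

Theorems-side engine (theorems only; no definition, no named fact, no `sorry`): the `q = 2` companion of p758548
`TwistRootNumberAnyTwo.rootNumber_quadraticTwist_mul_eq_of_nonsplit_odd_anyTwo` (`w(E^{(qℓ)}) = w(E)` at an ODD non-split
multiplicative Wan prime `q`). For `E / ℚ` (globally minimal `W`, modular, every ODD additive prime of quadratic-twist type) with
NON-SPLIT multiplicative reduction at `2`, an auxiliary good prime `ℓ ≥ 5` with `ℓ ≡ 1 (mod 8)` and `(2ℓ / r) = 1` at every odd
prime `r` of `N_E`:

  **`w(E^{(2ℓ)}) = w(E)`**   (`rootNumber_quadraticTwist_two_mul_eq_of_nonsplit_two`; literally the body of the skeleton's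
  `EngineTwo`, so that `stub_rootNumberDyadicWan : EngineTwo` is this theorem).

MODULAR proof (Rohrlich's local computation `w₂(E^{(2ℓ)}) = χ(−1) = (−1, 2ℓ)₂ = +1 = −a₂(E)` is not available in the tree at an
additive `2`): with `N_E = 2M₀`, the newform of `E' = E^{(2ℓ)}` is the double twist `(f_E ⊗ χ_ℓ) ⊗ χ₈` (`q`-expansion
`aₙ(E') = χ₈(n)(n/ℓ)aₙ(E)`: `E' = (E^{(ℓ)})^{(2)}`, `aₙ(X^{(2)}) = χ₈(n)aₙ(X)` for `X^{(2)}` additive at `2`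
— `QuadraticTwistTwoLFunctionProofs` —, `aₙ(E^{(ℓ*)}) = (n/ℓ)aₙ(E)`, `ℓ* = ℓ`) at level `N' = 64·M₀·ℓ² = (M₀ℓ²)·8²`, so
`λ₂(f_{E'}) = χ₈(−1) = +1` by the tree's «any modulus» law `atkinLehnerEigenvalueAt_charTwist_primePow_of_eq` (p762494, `m = 8`,
`N_E ℓ² ∣ 8·M₀ℓ²` BECAUSE `2 ∥ N_E`); `λ_ℓ(f_{E'}) = χ₄(ℓ) = +1`; `λ_r(f_{E'}) = λ_r(f_E)` at the odd bad `r` (`2ℓ` an `r`-adic square at a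
multiplicative `r`, `χ₄(r)` twice at an additive `r` of twist type); `λ₂(f_E) = w₂(E) = +1` iff `2` is NON-split; `N' = 32·N_E·ℓ²`
(`AdditiveBranchIMCTwistConductorDyadic`). Then `ε(f') = ∏ λ = ε(f)` and `w = −ε`.

* `atkinLehnerEigenvalueAt_two_eq_one_of_cuspCoeff_eq_χ₈_mul_legendreSym_mul` — the modular core (`λ₂ = χ₈(−1) = 1` for a form with the
  `q`-expansion of `(f ⊗ χ_ℓ) ⊗ χ₈` at level `M·8²`, `M` odd, `Nℓ² ∣ 8M`);
* `cuspCoeff_eq_χ₈_mul_legendreSym_mul_of_quadraticTwist_two_mul` — the curve side `aₙ(E^{(2ℓ)}) = χ₈(n)(n/ℓ)aₙ(E)`;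
* `rootNumber_quadraticTwist_two_mul_eq_of_nonsplit_two` — **the engine** (= `EngineTwo`);
* `fieldOneTwo` — the field supply `FieldOneTwo` UNCONDITIONALLY (`fieldOneTwo_of_engineTwo` of
  `AdditiveBranchIMCGordTwoRankOneFieldSupplyDyadic` fed with the engine): `stub_fieldOneDyadicWan stub_rootNumberDyadicWan` of the skeleton.

Falsifier of record (pen g43, kit pari j340408): 4 847 non-split pairs, 0 violations; 4 081 split pairs, 4 081 sign flips.
BSD is proved for no curve by any of this.
References: [Rohrlich1993Compositio] Prop. 2 (ii)–(iv), Prop. 3; [AtkinLi1978] §1, §3; [AtkinLehner1970] §6; [Knapp1993] Thm. 9.27;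
[SilvermanAEC2009] X.2 Prop. 2.4, X.5 Cor. 5.4.
-/

set_option linter.dupNamespace false
set_option autoImplicit false

noncomputable section

open scoped MatrixGroups Classical

open CongruenceSubgroup Literature.NumberTheory.EllipticCurves Literature.NumberTheory.EllipticCurves.ModularForms
  IsDedekindDomain IsDedekindDomain.HeightOneSpectrum NumberField Rat.HeightOneSpectrum WeierstrassCurve
  Summit.BirchSwinnertonDyer.BirchSwinnertonDyer.Theorems
  Summit.BirchSwinnertonDyer.BirchSwinnertonDyer.Theorems.TwistRootNumberAnyTwo

namespace Summit.BirchSwinnertonDyer.BirchSwinnertonDyer.Theorems.TwistRootNumberDyadic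

/-- `natGenerator` of the place of `ℤ` under a prime `p` is `p` (the tree's `Rat.natGenerator_primesEquiv_symm`). [folklore] -/
private theorem natGenerator_symm'' (p : Nat.Primes) : natGenerator ((primesEquiv (R := ℤ)).symm p) = p :=
  Literature.NumberTheory.EllipticCurves.Rat.natGenerator_primesEquiv_symm p

/-! ### §1 The Atkin–Lehner sign at `2` of the newform of `E^{(2ℓ)}`: the double twist `(f ⊗ χ_ℓ) ⊗ χ₈` and the «any modulus» law -/

section Modular

variable {ℓ : ℕ} [hℓ : Fact ℓ.Prime] {N L M : ℕ} [NeZero N] [NeZero L] [NeZero M] {k : ℤ}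

/-- **`λ₂(f') = 1` for a form `f' ∈ S_k(Γ₀(L))` with the `q`-expansion `aₙ(f') = χ₈(n)(n/ℓ)aₙ(f)` of the double twist
`(f ⊗ χ_ℓ) ⊗ χ₈` of `f ∈ S_k(Γ₀(N))`**, at a level `L = M·8²` with `M` odd and `Nℓ² ∣ 8M` (so that the intermediate twist
`f ⊗ χ_ℓ ∈ S_k(Γ₀(Nℓ²))` has level dividing `8M`): by the `q`-expansion principle `f'` IS `charTwist_{χ₈}(charTwist_{χ_ℓ} f)`
(`cuspCoeff_charTwist` twice, `χ_ℓ = (·/ℓ)` and `χ₈` primitive), and the Atkin–Lehner involution `w_{64}` acts on a `χ₈`-twist by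
`χ₈(−1) = +1` (`atkinLehnerEigenvalueAt_charTwist_primePow_of_eq`, Atkin–Lehner 1970 §6 / Atkin–Li 1978 §3 for the modulus `m = 8`).
[cite: AtkinLi1978, §3] [cite: AtkinLehner1970, §6] -/
theorem atkinLehnerEigenvalueAt_two_eq_one_of_cuspCoeff_eq_χ₈_mul_legendreSym_mul (hℓ2 : ℓ ≠ 2) (h2M : ¬ 2 ∣ M)
    (hL : L = M * 8 ^ 2) (hNM : N * ℓ ^ 2 ∣ M * 8) {f : CuspForm (Gamma0 N) k} {f' : CuspForm (Gamma0 L) k}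
    (hf'0 : f' ≠ 0)
    (hcoeff : ∀ n : ℕ, cuspCoeff f' n =
      (ZMod.χ₈.ringHomComp (Int.castRingHom ℂ)) n * (legendreSym ℓ n : ℂ) * cuspCoeff f n) :
    atkinLehnerEigenvalueAt f' 2 = 1 := by
  haveI : NeZero (N * ℓ ^ 2) := ⟨mul_ne_zero (NeZero.ne N) (pow_ne_zero _ hℓ.out.ne_zero)⟩
  haveI : NeZero (8 : ℕ) := ⟨by norm_num⟩
  set χℓ : DirichletCharacter ℂ ℓ := (quadraticChar (ZMod ℓ)).ringHomComp (Int.castRingHom ℂ) with hχℓ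
  set χ8 : DirichletCharacter ℂ 8 := ZMod.χ₈.ringHomComp (Int.castRingHom ℂ) with hχ8
  have hQℓ := isQuadratic_quadraticChar_ringHomComp ℓ
  have hPℓ := isPrimitive_quadraticChar_ringHomComp ℓ hℓ2
  have hQ8 : χ8.IsQuadratic := isQuadratic_χ₈_ringHomComp
  have hP8 : χ8.IsPrimitive := isPrimitive_χ₈_ringHomComp
  have hNN₁ : N ∣ N * ℓ ^ 2 := dvd_mul_right _ _
  have hℓN₁ : ℓ ^ 2 ∣ N * ℓ ^ 2 := dvd_mul_left _ _
  have hN₁L : N * ℓ ^ 2 ∣ L := hNM.trans (by rw [hL]; exact ⟨8, by ring⟩)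
  have h64L : 8 ^ 2 ∣ L := by rw [hL]; exact dvd_mul_left _ _
  -- the two twists
  set g₁ : CuspForm (Gamma0 (N * ℓ ^ 2)) k := charTwist (N * ℓ ^ 2) hNN₁ hℓN₁ hQℓ f with hg₁
  set g₂ : CuspForm (Gamma0 L) k := charTwist L hN₁L h64L hQ8 g₁ with hg₂
  -- `f'` IS the double twist
  have hfeq : f' = g₂ := by
    refine eq_of_forall_cuspCoeff_eq_gamma0 fun n ↦ ?_
    rw [hg₂, cuspCoeff_charTwist L hN₁L h64L hQ8 hP8 g₁ n, hg₁, cuspCoeff_charTwist (N * ℓ ^ 2) hNN₁ hℓN₁ hQℓ hPℓ f n,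
      hcoeff n, quadraticChar_ringHomComp_apply_natCast]
    ring
  rw [hfeq] at hf'0 ⊢
  rw [hg₂, atkinLehnerEigenvalueAt_charTwist_primePow_of_eq (p := 2) (a := 3) (M := M) Nat.prime_two h2M (by norm_num)
    (by norm_num) hL hNM hN₁L h64L hQ8 (by rw [← hg₂]; exact hf'0), hχ8, χ₈_ringHomComp_neg_one]

end Modular

/-! ### §2 The curve side: `aₙ(E^{(2ℓ)}) = χ₈(n)(n/ℓ)aₙ(E)` -/

/-- `ℓ* = ℓ` for `ℓ ≡ 1 (mod 4)`: `(−1)^{(ℓ−1)/2} = 1`. [folklore] -/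
theorem pStar_eq_self_of_mod_four_eq_one {ℓ : ℕ} (hℓ4 : ℓ % 4 = 1) : ((-1 : ℤ) ^ (ℓ / 2) * ℓ : ℤ) = ℓ := by
  have heven : Even (ℓ / 2) := ⟨ℓ / 4, by omega⟩
  rw [heven.neg_one_pow, one_mul]

/-- **`aₙ(f') = χ₈(n)(n/ℓ)aₙ(f)` for EVERY `n`**, for the newforms `f` of `E` and `f'` of `E' = E^{(2ℓ)}`, `ℓ ≡ 1 (mod 4)` prime, PROVIDED
`E'` is additive at `2` and at `ℓ` (e.g. `E` multiplicative at `2` and good at `ℓ`): `E' = (E^{(ℓ*)})^{(2)}` (`ℓ* = ℓ`), `aₙ(X^{(2)}) =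
χ₈(n)aₙ(X)` for `X^{(2)}` additive at `2` (`LFunction_quadraticTwist_two_apply`), `aₙ(E^{(ℓ*)}) = (n/ℓ)aₙ(E)` for `ℓ ∤ n`
(`LFunction_quadraticTwist_pStar_apply`); at `n` divisible by `ℓ` both sides vanish (`E'` additive at `ℓ`).
[cite: SilvermanAEC2009, X.2 Prop. 2.4, X.5 Cor. 5.4 and Exercise 10.16] -/
theorem cuspCoeff_eq_χ₈_mul_legendreSym_mul_of_quadraticTwist_two_mul (W : WeierstrassCurve ℚ) [W.IsElliptic] {ℓ : ℕ}
    [Fact ℓ.Prime] (hℓ4 : ℓ % 4 = 1) {v₂ vℓ : HeightOneSpectrum (𝓞 ℚ)} (hv₂ : (primesEquiv v₂ : ℕ) = 2)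
    (hvℓ : (primesEquiv vℓ : ℕ) = ℓ)
    (hadd₂ : (W.quadraticTwist (((2 : ℤ) * ℓ : ℤ) : ℚ)).HasAdditiveReductionAt v₂)
    (haddℓ : (W.quadraticTwist (((2 : ℤ) * ℓ : ℤ) : ℚ)).HasAdditiveReductionAt vℓ)
    {N N' : ℕ} [NeZero N] [NeZero N'] {f : CuspForm (Gamma0 N) 2} {f' : CuspForm (Gamma0 N') 2}
    (hf : IsNewformOf W f) (hf' : IsNewformOf (W.quadraticTwist (((2 : ℤ) * ℓ : ℤ) : ℚ)) f') (n : ℕ) :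
    cuspCoeff f' n = (ZMod.χ₈.ringHomComp (Int.castRingHom ℂ)) n * (legendreSym ℓ n : ℂ) * cuspCoeff f n := by
  have hℓ : ℓ.Prime := Fact.out
  have hℓ2 : ℓ ≠ 2 := by omega
  have hd0Z : ((2 : ℤ) * ℓ : ℤ) ≠ 0 := mul_ne_zero two_ne_zero (by exact_mod_cast hℓ.ne_zero)
  have hd0 : (((2 : ℤ) * ℓ : ℤ) : ℚ) ≠ 0 := by exact_mod_cast hd0Z
  haveI : (W.quadraticTwist (((2 : ℤ) * ℓ : ℤ) : ℚ)).IsElliptic := W.isElliptic_quadraticTwist hd0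
  rw [hf'.2 n, hf.2 n, χ₈_ringHomComp_apply_natCast]
  by_cases hℓn : ℓ ∣ n
  · have h0 : legendreSym ℓ n = 0 :=
      (legendreSym.eq_zero_iff ℓ n).mpr (by exact_mod_cast (ZMod.natCast_eq_zero_iff n ℓ).mpr hℓn)
    rw [LFunction_apply_eq_zero_of_hasAdditiveReductionAt _ hvℓ haddℓ hℓn, h0]
    push_cast
    ring
  -- away from `ℓ`: `E' = (E^{(ℓ*)})^{(2)}`
  have hls0Z : ((-1 : ℤ) ^ (ℓ / 2) * ℓ : ℤ) ≠ 0 := mul_ne_zero (pow_ne_zero _ (by norm_num)) (by exact_mod_cast hℓ.ne_zero)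
  have hls0 : (((-1 : ℤ) ^ (ℓ / 2) * ℓ : ℤ) : ℚ) ≠ 0 := by exact_mod_cast hls0Z
  haveI : (W.quadraticTwist (((-1 : ℤ) ^ (ℓ / 2) * ℓ : ℤ) : ℚ)).IsElliptic := W.isElliptic_quadraticTwist hls0
  have key : W.quadraticTwist (((2 : ℤ) * ℓ : ℤ) : ℚ) =
      (W.quadraticTwist (((-1 : ℤ) ^ (ℓ / 2) * ℓ : ℤ) : ℚ)).quadraticTwist 2 := by
    rw [quadraticTwist_quadraticTwist, pStar_eq_self_of_mod_four_eq_one hℓ4]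
    push_cast
    ring_nf
  have hadd' : ∀ v : HeightOneSpectrum (𝓞 ℚ), (primesEquiv v : ℕ) = 2 →
      ((W.quadraticTwist (((-1 : ℤ) ^ (ℓ / 2) * ℓ : ℤ) : ℚ)).quadraticTwist 2).HasAdditiveReductionAt v := by
    intro v hv
    have hvv : v = v₂ := primesEquiv.injective (Subtype.ext (by rw [hv, hv₂]))
    rw [← key, hvv]
    exact hadd₂
  rw [key, (W.quadraticTwist _).LFunction_quadraticTwist_two_apply hadd' n, W.LFunction_quadraticTwist_pStar_apply hℓ2 hℓn]
  push_cast
  ring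

/-! ### §3 The engine: `w(E^{(2ℓ)}) = w(E)` at a NON-SPLIT multiplicative `2` -/

/-- **The root number of the quadratic twist by `2ℓ` of a curve with NON-SPLIT multiplicative reduction at `2`** (the `q = 2` companion of
`TwistRootNumberAnyTwo.rootNumber_quadraticTwist_mul_eq_of_nonsplit_odd_anyTwo`; literally the body of the skeleton's `EngineTwo`): for
`E / ℚ` (globally minimal `W`, modular, every ODD additive prime of quadratic-twist type) with NON-SPLIT multiplicative reduction at `2`,
`ℓ ≥ 5` a good prime with `ℓ ≡ 1 (mod 8)` and `(2ℓ / r) = 1` at every odd prime `r` of `N_E`: `w(E^{(2ℓ)}) = w(E)`. MODULAR proof: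
`w = −ε(f)`, `ε(f) = ∏ λ_p(f)`, `N_{E^{(2ℓ)}} = 32 N_E ℓ²`; `λ₂(f') = χ₈(−1) = 1` (the newform of `E^{(2ℓ)}` is `(f ⊗ χ_ℓ) ⊗ χ₈` at level
`(M₀ℓ²)·8²`, `N_E = 2M₀`: `atkinLehnerEigenvalueAt_two_eq_one_of_cuspCoeff_eq_χ₈_mul_legendreSym_mul`), `λ_ℓ(f') = χ₄(ℓ) = 1`,
`λ_r(f') = λ_r(f)` at the odd bad `r`, and `λ₂(f) = w₂(E) = +1` exactly because `2` is NON-split. TRUE locally by Rohrlich: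
`w₂(E^{(2ℓ)}) = (−1, 2ℓ)₂ = +1`, `w_ℓ(E^{(2ℓ)}) = (−1/ℓ) = +1`. [cite: Rohrlich1993Compositio, Prop. 2 (ii)–(iv) and Prop. 3]
[cite: AtkinLi1978, §1 and §3] [cite: AtkinLehner1970, §6] [cite: Knapp1993, Thm. 9.27] -/
theorem rootNumber_quadraticTwist_two_mul_eq_of_nonsplit_two :
    ∀ (W : WeierstrassCurve ℚ) [W.IsElliptic] [W.IsGloballyMinimal], exists_isNewformOf →
    (∀ r : Nat.Primes, (r : ℕ) ≠ 2 → W.HasAdditiveReductionAt ((primesEquiv (R := ℤ)).symm r) →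
      ¬ (W.quadraticTwist (((-1 : ℤ) ^ ((r : ℕ) / 2) * r : ℤ) : ℚ)).HasAdditiveReductionAt
        ((primesEquiv (R := ℤ)).symm r)) →
    W.HasMultiplicativeReductionAtPrime 2 → ¬ W.HasSplitMultiplicativeReductionAtPrime 2 →
    ∀ (ℓ : ℕ) [Fact ℓ.Prime], 5 ≤ ℓ → W.HasGoodReductionAtPrime ℓ → (ℓ : ℤ) % 8 = 1 →
      (∀ r : ℕ, r.Prime → r ∣ W.conductorNorm ℤ → r ≠ 2 → jacobiSym ((2 : ℤ) * ℓ) r = 1) →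
      (W.quadraticTwist (((2 : ℤ) * ℓ : ℤ) : ℚ)).rootNumber = W.rootNumber := by
  intro W _ _ hmod htt h2m h2ns ℓ hℓ hℓ5 hℓg h8 hjac
  have hℓ2 : ℓ ≠ 2 := by omega
  have h2ℓ : (2 : ℕ) ≠ ℓ := fun h ↦ hℓ2 h.symm
  have hℓ4 : ℓ % 4 = 1 := by omega
  set d : ℤ := (2 : ℤ) * ℓ with hd
  have hd0 : d ≠ 0 := mul_ne_zero two_ne_zero (by exact_mod_cast hℓ.out.ne_zero)
  have hdQ : (d : ℚ) ≠ 0 := by exact_mod_cast hd0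
  set W' := W.quadraticTwist (d : ℚ) with hW'
  haveI : W'.IsElliptic := W.isElliptic_quadraticTwist hdQ
  set P2 : Nat.Primes := ⟨2, Nat.prime_two⟩ with hP2
  set Pℓ : Nat.Primes := ⟨ℓ, hℓ.out⟩ with hPℓ
  set v2 : HeightOneSpectrum ℤ := (primesEquiv (R := ℤ)).symm P2 with hv2
  set vℓ : HeightOneSpectrum ℤ := (primesEquiv (R := ℤ)).symm Pℓ with hvℓ
  set N := W.conductorNorm ℤ with hN
  set N' := W'.conductorNorm ℤ with hN'
  have hN0 : N ≠ 0 := (W.conductorNorm_pos_holds).ne'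
  have hN'0 : N' ≠ 0 := (W'.conductorNorm_pos_holds).ne'
  haveI : NeZero (W.conductorNorm ℤ) := ⟨hN0⟩
  haveI : NeZero (W'.conductorNorm ℤ) := ⟨hN'0⟩
  -- `d` is a square at the odd bad primes
  have hsq : ∀ p : Nat.Primes, (p : ℕ) ∣ N → (p : ℕ) ≠ 2 → haveI := Fact.mk p.2; IsSquare ((d : ℤ) : ℚ_[p]) := by
    intro p hpN hp2
    haveI := Fact.mk p.2
    exact isSquare_padic_of_jacobiSym_eq_one hp2 (hjac p p.2 hpN hp2)
  -- the conductor package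
  have hred := fun (p : Nat.Primes) (hp2 : (p : ℕ) ≠ 2) (hpℓ : p ≠ Pℓ) ↦ hasReductionAt_quadraticTwist_two_mul_iff W (ℓ := ℓ) p hp2 hpℓ
  have hfeq := fun (p : Nat.Primes) (hp2 : (p : ℕ) ≠ 2) (hpℓ : p ≠ Pℓ) ↦ conductorExponent_quadraticTwist_two_mul_eq W htt p hp2 hpℓ
  have hN'eq : N' = N * 2 ^ 5 * ℓ ^ 2 := conductorNorm_quadraticTwist_two_mul_eq W htt hℓ5 h2m hℓg
  have hle := conductorExponent_pStar_le W htt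
  have hle' := conductorExponent_pStar_quadraticTwist_two_mul_le W htt hℓ5
  have hℓodd : (ℓ : ℤ) % 2 = 1 := by exact_mod_cast Nat.odd_iff.mp (hℓ.out.odd_of_ne_two hℓ2)
  have hd4 : d % 4 = 2 := by rw [hd]; omega
  have hf2' : W'.conductorExponent v2 = 6 :=
    conductorExponent_quadraticTwist_eq_six_of_hasMultiplicativeReductionAtPrime_two W hd4 h2m
  have hf2 : W.conductorExponent v2 = 1 :=
    (conductorExponent_eq_one_iff_holds v2 W).mpr ((W.hasMultiplicativeReductionAtPrime_iff_hasMultiplicativeReductionAt_holds P2).mp h2m)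
  have haddℓ' : W'.HasAdditiveReductionAt vℓ := W.hasAdditiveReductionAt_quadraticTwist_mul_of_hasGoodReductionAtPrime hℓ2 h2ℓ hℓg
  have hfℓ' : W'.conductorExponent vℓ = 2 :=
    Literature.NumberTheory.EllipticCurves.conductorExponent_eq_two_of_five_le_holds W' vℓ (by rw [hvℓ, natGenerator_symm'']; exact hℓ5) haddℓ'
  have hfℓ : W.conductorExponent vℓ = 0 :=
    (conductorExponent_eq_zero_iff_holds vℓ W).mpr ((W.hasGoodReductionAtPrime_iff_hasGoodReductionAt_holds Pℓ).mp hℓg)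
  have hadd2' : W'.HasAdditiveReductionAt v2 := (two_le_conductorExponent_iff_holds v2 W').mp (by rw [hf2']; norm_num)
  have hdvd_iff : ∀ (n : ℕ) (hn : n ≠ 0) (p : Nat.Primes), (p : ℕ) ∣ n ↔ n.factorization p ≠ 0 := by
    intro n hn p
    rw [Ne, Nat.factorization_eq_zero_iff]
    push Not
    exact ⟨fun h ↦ ⟨p.2, h, hn⟩, fun h ↦ h.2.1⟩
  have h2N : (2 : ℕ) ∣ N := (hdvd_iff N hN0 P2).mpr (by rw [factorization_conductorNorm_primesEquiv_symm W P2, hf2]; norm_num)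
  have h4N : ¬ (2 : ℕ) ^ 2 ∣ N := by
    rw [Nat.prime_two.pow_dvd_iff_le_factorization hN0, show N.factorization 2 = N.factorization P2 from rfl,
      factorization_conductorNorm_primesEquiv_symm W P2, hf2]
    omega
  have hℓN : ¬ (ℓ : ℕ) ∣ N := fun h ↦ (hdvd_iff N hN0 Pℓ).mp h (by rw [factorization_conductorNorm_primesEquiv_symm W Pℓ, hfℓ])
  have h2mem : 2 ∈ N.primeFactors := Nat.mem_primeFactors.mpr ⟨Nat.prime_two, h2N, hN0⟩
  have hℓmem : ℓ ∉ N.primeFactors := fun h ↦ hℓN (Nat.mem_primeFactors.mp h).2.1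
  have hpf : N'.primeFactors = insert ℓ N.primeFactors := by
    rw [hN'eq, Nat.primeFactors_mul (mul_ne_zero hN0 (by norm_num)) (pow_ne_zero _ hℓ.out.ne_zero),
      Nat.primeFactors_mul hN0 (by norm_num), Nat.primeFactors_pow _ two_ne_zero, Nat.primeFactors_pow _ (by norm_num),
      Nat.prime_two.primeFactors, hℓ.out.primeFactors,
      Finset.union_eq_left.mpr (Finset.singleton_subset_iff.mpr h2mem), Finset.union_comm, ← Finset.insert_eq]
  -- `N = 2 M₀` with `M₀` odd; the level of `E'` is `(M₀ ℓ²) · 8²`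
  obtain ⟨M₀, hM₀⟩ := h2N
  have hM₀odd : ¬ 2 ∣ M₀ := by
    rintro ⟨c, rfl⟩
    exact h4N ⟨c, by rw [hM₀]; ring⟩
  have hM₀0 : M₀ ≠ 0 := by rintro rfl; exact hN0 (by rw [hM₀])
  haveI : NeZero (M₀ * ℓ ^ 2) := ⟨mul_ne_zero hM₀0 (pow_ne_zero _ hℓ.out.ne_zero)⟩
  have hModd : ¬ 2 ∣ M₀ * ℓ ^ 2 := by
    intro h
    rcases (Nat.Prime.dvd_mul Nat.prime_two).mp h with h | h
    · exact hM₀odd h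
    · exact hℓ2 ((Nat.prime_dvd_prime_iff_eq Nat.prime_two hℓ.out).mp (Nat.prime_two.dvd_of_dvd_pow h)).symm
  have hLeq : N' = M₀ * ℓ ^ 2 * 8 ^ 2 := by rw [hN'eq, hM₀]; ring
  have hNM : N * ℓ ^ 2 ∣ M₀ * ℓ ^ 2 * 8 := ⟨4, by rw [hM₀]; ring⟩
  -- newforms
  obtain ⟨f, hf⟩ := hmod W
  obtain ⟨f', hf'⟩ := hmod W'
  have hε := IsNewform0.frickeEigenvalue_eq_prod_atkinLehnerEigenvalueAt_holds hf.1
  have hε' := IsNewform0.frickeEigenvalue_eq_prod_atkinLehnerEigenvalueAt_holds hf'.1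
  have hf'0 : f' ≠ 0 := fun h0 ↦ hf'.1.coe_ne_zero (by rw [h0]; rfl)
  -- `λ_ℓ(f') = χ₄ ℓ`
  have hlaml_tw : atkinLehnerEigenvalueAt f' ℓ = (ZMod.χ₄ ℓ : ℂ) :=
    W'.atkinLehnerEigenvalueAt_eq_χ₄_of_twist_of_le hmod hf' Pℓ hℓ2 haddℓ'
      (W.not_hasAdditiveReductionAt_quadraticTwist_mul_pStar_right hℓ2 h2ℓ hℓg) hfℓ' (hle' Pℓ hℓ2)
  -- `λ₂(f') = χ₈(−1) = 1` (the dyadic content)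
  have hlam2_tw : atkinLehnerEigenvalueAt f' 2 = 1 := by
    set w2 : HeightOneSpectrum (𝓞 ℚ) := (primesEquiv (R := 𝓞 ℚ)).symm P2 with hw2
    set wℓ : HeightOneSpectrum (𝓞 ℚ) := (primesEquiv (R := 𝓞 ℚ)).symm Pℓ with hwℓ
    have hw2v : (primesEquiv w2 : ℕ) = 2 := by rw [hw2, Equiv.apply_symm_apply]
    have hwℓv : (primesEquiv wℓ : ℕ) = ℓ := by rw [hwℓ, Equiv.apply_symm_apply]
    have hadd2O : W'.HasAdditiveReductionAt w2 := (W'.hasAdditiveReductionAt_int_iff_ringOfIntegers P2).mp hadd2'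
    have haddℓO : W'.HasAdditiveReductionAt wℓ := (W'.hasAdditiveReductionAt_int_iff_ringOfIntegers Pℓ).mp haddℓ'
    have hcoeff := cuspCoeff_eq_χ₈_mul_legendreSym_mul_of_quadraticTwist_two_mul W hℓ4 hw2v hwℓv hadd2O haddℓO hf hf'
    exact atkinLehnerEigenvalueAt_two_eq_one_of_cuspCoeff_eq_χ₈_mul_legendreSym_mul (M := M₀ * ℓ ^ 2) hℓ2 hModd hLeq hNM
      hf'0 hcoeff
  -- `λ₂(f) = 1` (NON-split)
  have hlam2 : atkinLehnerEigenvalueAt f 2 = 1 := by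
    have h := W.atkinLehnerEigenvalueAt_eq_localRootNumberAt_of_not_sq_dvd hf P2 ⟨M₀, hM₀⟩ h4N
    rw [h, localRootNumberAt_primesEquiv_symm_eq, localRootNumber_of_hasMultiplicativeReduction _ _ h2m h2ns]
    simp
  -- `λ_r(f') = λ_r(f)` at the odd primes of `N`
  have hlam_eq : ∀ r ∈ N.primeFactors.erase 2, atkinLehnerEigenvalueAt f' r = atkinLehnerEigenvalueAt f r := by
    intro r hr
    obtain ⟨hr2, hrN⟩ := Finset.mem_erase.mp hr
    obtain ⟨hrp, hrdvd, -⟩ := Nat.mem_primeFactors.mp hrN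
    have hrℓ : r ≠ ℓ := fun h ↦ hℓN (h ▸ hrdvd)
    set R : Nat.Primes := ⟨r, hrp⟩
    have hRℓ : R ≠ Pℓ := fun h ↦ hrℓ (congrArg Subtype.val h)
    haveI := Fact.mk hrp
    have hbad : ¬ W.HasGoodReductionAt ((primesEquiv (R := ℤ)).symm R) := fun hg ↦
      ((W.dvd_conductorNorm_iff_not_hasGoodReductionAtPrime r).mp hrdvd)
        ((W.hasGoodReductionAtPrime_iff_hasGoodReductionAt_holds R).mpr hg)
    rcases hasGoodReductionAt_or_hasMultiplicativeReductionAt_or_hasAdditiveReductionAt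
      ((primesEquiv (R := ℤ)).symm R) W with h | hm | ha
    · exact absurd h hbad
    · -- multiplicative: both are the local root number, and `W' ≅ W` over `ℚ_r` (`2ℓ` an `r`-adic square)
      have hf1 : W.conductorExponent ((primesEquiv (R := ℤ)).symm R) = 1 := (conductorExponent_eq_one_iff_holds _ W).mpr hm
      have hf1' : W'.conductorExponent ((primesEquiv (R := ℤ)).symm R) = 1 := by rw [hfeq R hr2 hRℓ, hf1]
      have hrN' : r ∣ N' := (hdvd_iff N' hN'0 R).mpr (by rw [factorization_conductorNorm_primesEquiv_symm W' R, hf1']; norm_num)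
      have hrrN' : ¬ r ^ 2 ∣ N' := by
        rw [hrp.pow_dvd_iff_le_factorization hN'0, show N'.factorization r = N'.factorization R from rfl,
          factorization_conductorNorm_primesEquiv_symm W' R, hf1']
        omega
      have hrrN : ¬ r ^ 2 ∣ N := by
        rw [hrp.pow_dvd_iff_le_factorization hN0, show N.factorization r = N.factorization R from rfl,
          factorization_conductorNorm_primesEquiv_symm W R, hf1]
        omega
      rw [W'.atkinLehnerEigenvalueAt_eq_localRootNumberAt_of_not_sq_dvd hf' R hrN' hrrN',
        W.atkinLehnerEigenvalueAt_eq_localRootNumberAt_of_not_sq_dvd hf R hrdvd hrrN,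
        W.localRootNumberAt_quadraticTwist_of_isSquare R hd0 (hsq R hrdvd hr2)]
    · -- additive (odd, twist type): both are `χ₄ r`
      have hps0 : (((-1 : ℤ) ^ (r / 2) * r : ℤ) : ℚ) ≠ 0 := by
        have : (-1 : ℤ) ^ (r / 2) * r ≠ 0 := mul_ne_zero (pow_ne_zero _ (by norm_num)) (by exact_mod_cast hrp.ne_zero)
        exact_mod_cast this
      haveI := W.isElliptic_quadraticTwist hps0
      have hsemi := htt R hr2 ha
      have ha' : W'.HasAdditiveReductionAt ((primesEquiv (R := ℤ)).symm R) := (hred R hr2 hRℓ).2.2.mpr ha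
      have hR2' : R ≠ ⟨2, (Fact.out : Nat.Prime 2)⟩ := fun h ↦ hr2 (congrArg Subtype.val h)
      have hsemi' : ¬ (W'.quadraticTwist (((-1 : ℤ) ^ ((R : ℕ) / 2) * R : ℤ) : ℚ)).HasAdditiveReductionAt
          ((primesEquiv (R := ℤ)).symm R) := by
        rw [hW', hd]
        exact twistType_quadraticTwist_of_not_dvd W htt _ R hr2
          (by exact_mod_cast not_natGenerator_dvd_mul (q := 2) (ℓ := ℓ) R hR2' hRℓ) ha
      rw [W'.atkinLehnerEigenvalueAt_eq_χ₄_of_twist_of_le hmod hf' R hr2 ha' hsemi'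
          (TwistTypeConductor.conductorExponent_eq_two_of_twistType_odd W' R hr2 ha' (fun _ ↦ hsemi')) (hle' R hr2),
        W.atkinLehnerEigenvalueAt_eq_χ₄_of_twist_of_le hmod hf R hr2 ha hsemi
          (TwistTypeConductor.conductorExponent_eq_two_of_twistType_odd W R hr2 ha (fun _ ↦ hsemi)) (hle R hr2)]
  -- the products
  have hP : ∏ r ∈ N.primeFactors.erase 2, atkinLehnerEigenvalueAt f' r =
      ∏ r ∈ N.primeFactors.erase 2, atkinLehnerEigenvalueAt f r := Finset.prod_congr rfl hlam_eq
  have hχ : (ZMod.χ₄ ℓ : ℂ) = 1 := by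
    have h4 : ZMod.χ₄ ℓ = 1 := by
      rw [ZMod.χ₄_nat_eq_if_mod_four, if_neg (by omega), if_pos hℓ4]
    exact_mod_cast congrArg (fun z : ℤ ↦ (z : ℂ)) h4
  have hεeq : frickeEigenvalue f' = frickeEigenvalue f := by
    rw [hε', hε, hpf, Finset.prod_insert hℓmem, ← Finset.mul_prod_erase _ _ h2mem,
      ← Finset.mul_prod_erase N.primeFactors _ h2mem, hlaml_tw, hlam2_tw, hlam2, hP, hχ, one_mul]
  have hw' := rootNumber_eq_neg_frickeEigenvalue (W := W') (fun _ _ ↦ IsNewform0.exists_functional_equation_holds)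
    (fun _ _ ↦ IsNewform0.frickeEigenvalue_eq_one_or_eq_neg_one_holds) hf'
  have hw := rootNumber_eq_neg_frickeEigenvalue (W := W) (fun _ _ ↦ IsNewform0.exists_functional_equation_holds)
    (fun _ _ ↦ IsNewform0.frickeEigenvalue_eq_one_or_eq_neg_one_holds) hf
  have h : ((W'.rootNumber : ℤ) : ℂ) = ((W.rootNumber : ℤ) : ℂ) := by rw [hw', hw, hεeq]
  exact_mod_cast h

/-! ### §4 The field supply with `2` ramified, unconditionally -/

/-- **The rank-one field supply `FieldOneTwo` of the skeleton, UNCONDITIONALLY** (= `stub_fieldOneDyadicWan stub_rootNumberDyadicWan`): for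
`E / ℚ` (globally minimal `W`, modular, odd additive primes of quadratic-twist type, NON-SPLIT multiplicative at `2`) with `w(E) = −1`,
Hoffstein–Luo 1997 as a named hypothesis, every odd prime `p` and bound `B`: an imaginary quadratic `K` with `|d_K| > B`, `2 ∣ d_K`, the odd
primes of `N_E` split, `p` split, `L(E^{(d_K)}, 1) ≠ 0` — `fieldOneTwo_of_engineTwo` fed with `rootNumber_quadraticTwist_two_mul_eq_of_nonsplit_two`.
[cite: HoffsteinLuo1997, Theorem (§1, pp. 435–436)] [cite: FriedbergHoffstein1995, Thm. B] -/
theorem fieldOneTwo :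
    ∀ (W : WeierstrassCurve ℚ) [W.IsElliptic] [W.IsGloballyMinimal], exists_isNewformOf →
    Literature.NumberTheory.EllipticCurves.HoffsteinLuo1997_exists_twist_L_one_ne_zero →
    (∀ r : Nat.Primes, (r : ℕ) ≠ 2 → W.HasAdditiveReductionAt ((primesEquiv (R := ℤ)).symm r) →
      ¬ (W.quadraticTwist (((-1 : ℤ) ^ ((r : ℕ) / 2) * r : ℤ) : ℚ)).HasAdditiveReductionAt
        ((primesEquiv (R := ℤ)).symm r)) →
    W.rootNumber = -1 → W.HasMultiplicativeReductionAtPrime 2 → ¬ W.HasSplitMultiplicativeReductionAtPrime 2 →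
    ∀ (p : ℕ), p.Prime → p ≠ 2 → ∀ B : ℕ,
      ∃ (K : Type) (_ : Field K) (_ : NumberField K),
        IsImaginaryQuadratic K ∧ B < (NumberField.discr K).natAbs ∧ (2 : ℤ) ∣ NumberField.discr K ∧
          (∀ ℓ : ℕ, ℓ.Prime → ℓ ∣ W.conductorNorm ℤ → ℓ ≠ 2 →
            ((Ideal.span {(ℓ : ℤ)}).primesOver (𝓞 K)).ncard = 2) ∧
          SatisfiesHeegnerHypothesis p K ∧
          (W.quadraticTwist (NumberField.discr K : ℚ)).entireLFunction 1 ≠ 0 :=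
  fieldOneTwo_of_engineTwo rootNumber_quadraticTwist_two_mul_eq_of_nonsplit_two

end Summit.BirchSwinnertonDyer.BirchSwinnertonDyer.Theorems.TwistRootNumberDyadic

end
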